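import Summits.Ventures.HSemireg.WeilFrameWeilLines

/-!
# Venture HSemireg — THE WEIL LINES ARE THE TOP LINES: `E± ⊆ H²ⁿ(A(ℂ); ℂ)` carried into `ΛH¹(A)` EQUALS `(⋀^{2n} V±).map (ΛV± → ΛH¹)`

HONEST FRAMING. Part of the Lean index of the computation cell `pub-hsemireg` (seat w3-mod4-1 gen 9, W3 SPECIAL FIBRES,
MOD4-OFFSPLIT §1 / §13: the dictionary item «`W_K ⊗ ℂ = det H¹₊ ⊕ det H¹₋`»). The tree's real carriers and the Literature's Weil-type
layer ONLY: no semiregularity map is constructed; nothing here says that HC / HC_CM / HC_AV holds; nothing here is a claim about any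
explicit variety; no Literature fact is declared; NO definition is introduced.

WHAT IS PROVED. `map_weilClassesPlus_eq_topLine` / `map_weilClassesMinus_eq_topLine`: for `A` of dimension `2n`,
`φ ≫ φ = -(d • 𝟙 A)`, `d ≥ 1`, `P = V₊` (resp. `Q = V₋`, the `±i√d`-eigenspaces of `φ*` on `H¹(A; ℂ)`): the tree's Weil line
`E₊ = weilClassesPlus A φ n d` (resp. `E₋`), carried into `ΛH¹(A)` by `(equiv A (2n))⁻¹` and the inclusion of `⋀²ⁿH¹`, IS the top
line `(⋀^{dim P} P).map (ΛP → ΛH¹)` («`det V₊`») — gen 8's inclusion `exteriorOf_mem_topLine_of_mem_weilClassesPlus/Minus` plus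
`dim E± = 1` (Literature `finrank_weilClassesPlus/Minus_eq_one`) and `dim topLine ≤ 1` (`finrank_topLine_le_one`). So in the
frame-free theorems «`w± ≠ 0` in the top line of `V±`» and «`c± ≠ 0` in `E±`» are the SAME data. Everything PROVED, 0 sorry.
References: [vanGeemen1994HodgeAV] 4.9 and proof of Thm. 6.12; [BourbakiAlgebre1a3] Ch. III §7 no. 8.
-/

noncomputable section

open Module CategoryTheory
open Literature.AlgebraicGeometry.Motives Literature.AlgebraicGeometry.HodgeTheory
open Literature.AlgebraicTopology.SingularHomology

namespace Summit.Ventures.HSemireg.WeilFrame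

variable {A : AbelianVariety ℂ}

/-- **`E₊` carried into `ΛH¹` IS the top line of `V₊`:** for `A` of dimension `2n`, `φ ≫ φ = -(d • 𝟙 A)`, `d ≥ 1`, `P = V₊`:
`((weilClassesPlus A φ n d).map (equiv A (2n))⁻¹).map (⋀²ⁿH¹ ↪ ΛH¹) = (⋀^{dim P} P).map (ΛP → ΛH¹)` — both are lines and the left
one lies in the right one. [cite: vanGeemen1994HodgeAV, 4.9 and proof of Thm. 6.12] [cite: BourbakiAlgebre1a3, Ch. III §7 no. 8] -/
theorem map_weilClassesPlus_eq_topLine {n d : ℕ} (hdim : A.dim = n + n) (hd : 0 < d) {φ : A ⟶ A}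
    (hφ : φ ≫ φ = -(d • 𝟙 A)) {P : Submodule ℂ (complexBetti A.X 1)}
    (hP : P = Module.End.eigenspace (complexBetti.map φ.hom.hom.hom 1).hom (Complex.I * (Real.sqrt d : ℂ))) :
    ((weilClassesPlus A φ n d).map
        ((abelianVarietyCohomologyExteriorH1_holds.equiv A (2 * n)).symm :
          complexBetti A.X (2 * n) →ₗ[ℂ] ↥(⋀[ℂ]^(2 * n) (complexBetti A.X 1)))).map
        (⋀[ℂ]^(2 * n) (complexBetti A.X 1)).subtype =
      (⋀[ℂ]^(finrank ℂ ↥P) ↥P).map (ExteriorAlgebra.map P.subtype).toLinearMap := by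
  haveI : Module.Finite ℂ (complexBetti A.X 1) := abelianVarietyCohomologyExteriorH1_holds.finite_one A
  have hb₁ : finrank ℂ (complexBetti A.X 1) = 2 * (2 * n) := by
    rw [Literature.AlgebraicGeometry.Motives.AbelianVariety.finrank_complexBetti_one, hdim]; ring
  refine Submodule.eq_of_le_of_finrank_le ?_ ?_
  · rintro _ ⟨_, ⟨c, hc, rfl⟩, rfl⟩
    exact exteriorOf_mem_topLine_of_mem_weilClassesPlus hdim hd hφ hP hc
  · rw [Submodule.finrank_map_subtype_eq, LinearEquiv.finrank_map_eq,
      finrank_weilClassesPlus_eq_one (abelianVarietyCohomologyExteriorH1_holds.hasExteriorCohomologyH1 A) hb₁ hd hφ]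
    exact finrank_topLine_le_one P

/-- **`E₋` carried into `ΛH¹` IS the top line of `V₋`** (`Q = V₋`). [cite: vanGeemen1994HodgeAV, 4.9 and proof of Thm. 6.12] -/
theorem map_weilClassesMinus_eq_topLine {n d : ℕ} (hdim : A.dim = n + n) (hd : 0 < d) {φ : A ⟶ A}
    (hφ : φ ≫ φ = -(d • 𝟙 A)) {Q : Submodule ℂ (complexBetti A.X 1)}
    (hQ : Q = Module.End.eigenspace (complexBetti.map φ.hom.hom.hom 1).hom (-(Complex.I * (Real.sqrt d : ℂ)))) :
    ((weilClassesMinus A φ n d).map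
        ((abelianVarietyCohomologyExteriorH1_holds.equiv A (2 * n)).symm :
          complexBetti A.X (2 * n) →ₗ[ℂ] ↥(⋀[ℂ]^(2 * n) (complexBetti A.X 1)))).map
        (⋀[ℂ]^(2 * n) (complexBetti A.X 1)).subtype =
      (⋀[ℂ]^(finrank ℂ ↥Q) ↥Q).map (ExteriorAlgebra.map Q.subtype).toLinearMap := by
  haveI : Module.Finite ℂ (complexBetti A.X 1) := abelianVarietyCohomologyExteriorH1_holds.finite_one A
  have hb₁ : finrank ℂ (complexBetti A.X 1) = 2 * (2 * n) := by
    rw [Literature.AlgebraicGeometry.Motives.AbelianVariety.finrank_complexBetti_one, hdim]; ring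
  refine Submodule.eq_of_le_of_finrank_le ?_ ?_
  · rintro _ ⟨_, ⟨c, hc, rfl⟩, rfl⟩
    exact exteriorOf_mem_topLine_of_mem_weilClassesMinus hdim hd hφ hQ hc
  · rw [Submodule.finrank_map_subtype_eq, LinearEquiv.finrank_map_eq,
      finrank_weilClassesMinus_eq_one (abelianVarietyCohomologyExteriorH1_holds.hasExteriorCohomologyH1 A) hb₁ hd hφ]
    exact finrank_topLine_le_one Q

end Summit.Ventures.HSemireg.WeilFrame

end
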